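import Summits.QuantumFields.YangMills.Theorems.BalabanUVNodesN15KingModelIsserlisHafnian
import Summits.QuantumFields.YangMills.Theorems.BalabanUVNodesN15KingModelBlockFieldLawIdentification
import Summits.QuantumFields.YangMills.Theorems.BalabanUVNodesN15KingModelTwoPointJointLimit

/-!
# BalabanUVNodes ∕ N15 — THE KING-MODEL RUNG (PART Ͱ-c): ALL `n`-POINT SCHWINGER FUNCTIONS OF KING's FREE BLOCK FIELDS ARE HAFNIANS — of `S₂^{(K)}` for the
# block averages of the fine free field, of `(Δ^{(K)})⁻¹` for the RG block-field measures `dμ^{(K)}`, at every `K` and at `K = ∞`; odd ones vanish; every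
# `n`-point function converges as `K → ∞`, AND WITH THE (4.38)-SHAPE RATE: `|S_n^{(K)} − S_n^{(∞)}| ≤ (n−1)!!·(n∕2)·m^{−(n−2)}·(2C_diff + a_∞⁻¹)·L^{−K}`
# (volume-free) — the η-rate of NE2's unit layer propagated to ALL Schwinger functions in the model
# (Track A, DAG node N15 = NE2; FAN-OUT v1.1 §N15 s3 «KING-MODEL RUNG»; uses parts Ͱ-b (Isserlis), Ϝ-d∕Ϝ-l (two-point kernels, uniform rate), Ϝ-r∕Ϝ-s∕Ϝ-v
# (the laws), Ϡ-g (`C^{(∞)}`); count-neutral)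

HONEST FRAMING.  Count-neutral (cell `pub-ymgap`, seat `pub-ymgap-dag-n15-e` g34; `--supports stmt-QuantumFields-27366 --as helper` = K3⁸
`SpineGivenEndpointR13SepCoPHV`).  King's `A = 0`, `g = 0` model ([King1986] C. King, Commun. Math. Phys. **102** (1986) 649–677): the free covariance of §2
on a unit torus `𝕋_M`, fine torus `T_{1∕N}`, `N = L^K`, odd `L ≥ 2` (for the limits), `m² > 0`, auxiliary `a > 0`.  Parts Ϝ-s∕Ϝ-t∕Ϝ-v gave the two- and
four-point functions of the two block-field laws of the rung — the law `ρ_{P_K}dφ`, `P_K = (S₂^{(K)})⁻¹`, of the block averages of the fine free field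
(covariance `kingS2`, part Ϝ-d) and King's RG block-field measure `dμ^{(K)} = ρ_{Δ^{(K)}}dψ` (covariance `blockCov = (Δ^{(K)})⁻¹`, g0) — and their `K → ∞`
limits.  With part Ͱ-b's Isserlis theorem this file gives ALL `n`-point functions at once as HAFNIANS (the tree's `Literature.Combinatorics.Enumerative.hafnian`)
of the two-point kernel on the chosen points, their vanishing for odd `n`, their convergence as `K → ∞` (the hafnian is a polynomial in the entries), and —
the node's theme — their RATE: a Lipschitz estimate for the hafnian (`|Haf B − Haf B′| ≤ #matchings·k·β^{k−1}·ε` on `2k` indices when `|B|,|B′| ≤ β`,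
`|B − B′| ≤ ε`) fed with part Ϝ-d's uniform bound `|S₂^{(K)}| ≤ m⁻²` and part Ϝ-l's volume-free (4.38) rate `|S₂^{(K)} − S₂^{(∞)}| ≤ (2C_diff + a_∞⁻¹)L^{−K}`.
NOT a node discharge (N15 is booked through n15-a's knit, untouched here); nothing Bałaban ∕ continuum-Yang–Mills ∕ `ℝ⁴` ∕ OS ∕ mass-gap ∕ Clay.  0 `sorry`,
0 def; standard axioms.

WHAT THIS FILE PROVES (kernel).  §1 (hafnian analysis, generic over `ℝ`): `tendsto_hafnian_of_entries`, ★ `abs_prod_sub_prod_le` (products are Lipschitz),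
★★ `abs_hafnian_sub_hafnian_le` (every index type), `abs_hafnian_sub_hafnian_le_of_card` (`2k` indices: `(2k−1)!!·k·β^{k−1}·ε`); §2 FINE SIDE: ★★★
**`integral_prod_eval_fineBlockLaw_eq_hafnian`** (`∫∏_{i∈S}φ(p_i)ρ_{P_K}(φ)dφ = Haf((S₂^{(K)}(p_u,p_v))_{u,v∈S})`), `integral_prod_dot_fineBlockLaw_eq_hafnian` (smeared),
★★ `integral_prod_eval_fineBlockLawLim_eq_hafnian` (`K = ∞`, `S₂^{(∞)}`), `integral_prod_eval_fineBlockLaw_eq_zero_of_odd`, ★★ `tendsto_integral_prod_eval_fineBlockLaw`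
(EVERY `n`-point function converges), ★★★ **`abs_integral_prod_eval_fineBlockLaw_sub_lim_le`** (THE RATE `(2k−1)!!·k·m^{−2(k−1)}·(2C_diff + a_∞⁻¹)·L^{−K}`, every
`K ≥ 1`, every `2k` points, volume-free); §3 RG SIDE: ★★★ **`integral_prod_eval_blockFieldLaw_eq_hafnian`** (`∫∏ψ(p_i)dμ^{(K)} = Haf(((Δ^{(K)})⁻¹(p_u,p_v)))`, `K ≥ 1`),
★★ `integral_prod_eval_blockFieldLawLim_eq_hafnian` (`dμ^{(∞)}`, `C^{(∞)}`), `integral_prod_eval_blockFieldLaw_eq_zero_of_odd`, ★★ `tendsto_integral_prod_eval_blockFieldLaw`,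
★★ `integral_prod_eval_gaussianFieldOfKernel_blockCov_eq_hafnian` (the same read on the tree's `gaussianFieldOfKernel (blockCov K)` through part Ϝ-v).

WHAT THE CURVED CASE ADDS (one line).  Nothing new in kind: Bałaban's block fields at `U ≡ 1` are these; at `U ≠ 1` the measures are not Gaussian and no
hafnian formula exists — the η-rates of NE2 concern the KERNELS, which is what parts Β∕Ϡ∕Ϝ typed.
HONEST SCOPE.  King's free model only; finite unit torus; constants `C_diff = CdiffM`, `a_∞ = aInf` of the tree, not optimised; the rate is stated for the fine
side (where `|S₂^{(K)}| ≤ m⁻²` is uniform in `K`).  N15 untouched; counts unmoved.  Locators (use): [King1986] (2.6) p.652, (2.13)–(2.16) p.653, Thm 2.1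
(2.22)–(2.23) p.654, Lemma 4.5 (4.38) p.674.
-/

noncomputable section

open scoped BigOperators
open Finset Matrix Filter Topology MeasureTheory

/-! ## §1 Hafnian analysis over `ℝ`: continuity in the entries and a Lipschitz estimate -/

namespace Summit.QuantumFields.YangMills.BalabanUVNodes.N15KingModelRung.FreeField

open Literature.Combinatorics.Enumerative (hafnian perfectMatchings mem_perfectMatchings card_filter_lt_of_mem_perfectMatchings
  card_perfectMatchings)

section HafnianAnalysis

variable {V : Type*} [Fintype V] [DecidableEq V] [LinearOrder V]

/-- The hafnian is continuous in the entries: entrywise convergence of the matrices gives convergence of the hafnians (a finite sum of finite products).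
[folklore] -/
theorem tendsto_hafnian_of_entries {f : ℕ → Matrix V V ℝ} {g : Matrix V V ℝ}
    (h : ∀ u v, Tendsto (fun K => f K u v) atTop (𝓝 (g u v))) :
    Tendsto (fun K => hafnian (f K)) atTop (𝓝 (hafnian g)) := by
  unfold hafnian
  exact tendsto_finsetSum _ fun τ _ => tendsto_finsetProd _ fun v _ => h v (τ v)

omit [Fintype V] [LinearOrder V] in
/-- ★ **Products are Lipschitz**: if `|f_i|, |g_i| ≤ β` and `|f_i − g_i| ≤ ε` on `s`, then `|∏_s f − ∏_s g| ≤ |s|·β^{|s|−1}·ε`. [folklore] -/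
theorem abs_prod_sub_prod_le (s : Finset V) {f g : V → ℝ} {β ε : ℝ} (hβ : 0 ≤ β) (hf : ∀ i ∈ s, |f i| ≤ β)
    (hg : ∀ i ∈ s, |g i| ≤ β) (hfg : ∀ i ∈ s, |f i - g i| ≤ ε) :
    |∏ i ∈ s, f i - ∏ i ∈ s, g i| ≤ s.card * β ^ (s.card - 1) * ε := by
  induction s using Finset.induction_on with
  | empty => simp
  | insert a s ha ih =>
    have hf' : ∀ i ∈ s, |f i| ≤ β := fun i hi => hf i (Finset.mem_insert_of_mem hi)
    have hg' : ∀ i ∈ s, |g i| ≤ β := fun i hi => hg i (Finset.mem_insert_of_mem hi)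
    have hfg' : ∀ i ∈ s, |f i - g i| ≤ ε := fun i hi => hfg i (Finset.mem_insert_of_mem hi)
    have hε : 0 ≤ ε := (abs_nonneg _).trans (hfg a (Finset.mem_insert_self a s))
    have hP : |∏ i ∈ s, f i| ≤ β ^ s.card := by
      rw [Finset.abs_prod]
      calc ∏ i ∈ s, |f i| ≤ ∏ _i ∈ s, β := Finset.prod_le_prod (fun i _ => abs_nonneg _) hf'
        _ = β ^ s.card := Finset.prod_const β
    rw [Finset.prod_insert ha, Finset.prod_insert ha, Finset.card_insert_of_notMem ha]
    have e : f a * ∏ i ∈ s, f i - g a * ∏ i ∈ s, g i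
        = (f a - g a) * ∏ i ∈ s, f i + g a * (∏ i ∈ s, f i - ∏ i ∈ s, g i) := by ring
    rw [e]
    calc |(f a - g a) * ∏ i ∈ s, f i + g a * (∏ i ∈ s, f i - ∏ i ∈ s, g i)|
        ≤ |f a - g a| * |∏ i ∈ s, f i| + |g a| * |∏ i ∈ s, f i - ∏ i ∈ s, g i| := by
          refine (abs_add_le _ _).trans ?_
          rw [abs_mul, abs_mul]
      _ ≤ ε * β ^ s.card + β * (s.card * β ^ (s.card - 1) * ε) :=
          add_le_add (mul_le_mul (hfg a (Finset.mem_insert_self a s)) hP (abs_nonneg _) hε)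
            (mul_le_mul (hg a (Finset.mem_insert_self a s)) (ih hf' hg' hfg') (abs_nonneg _) hβ)
      _ = ((s.card + 1 : ℕ) : ℝ) * β ^ (s.card + 1 - 1) * ε := by
          rcases Nat.eq_zero_or_pos s.card with h | h
          · rw [h]; simp
          · obtain ⟨n, hn⟩ : ∃ n, s.card = n + 1 := ⟨s.card - 1, by omega⟩
            rw [hn]
            simp only [Nat.add_sub_cancel, pow_succ, Nat.cast_add, Nat.cast_one]
            ring

/-- ★★ **THE HAFNIAN IS LIPSCHITZ IN THE ENTRIES**: if `|B|, |B′| ≤ β` and `|B − B′| ≤ ε` entrywise, then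
`|Haf B − Haf B′| ≤ #(perfect matchings)·(|V|∕2)·β^{|V|∕2−1}·ε` (each matching product has `|V|∕2` factors). [folklore] -/
theorem abs_hafnian_sub_hafnian_le {B B' : Matrix V V ℝ} {β ε : ℝ} (hβ : 0 ≤ β) (hB : ∀ u v, |B u v| ≤ β)
    (hB' : ∀ u v, |B' u v| ≤ β) (hBB' : ∀ u v, |B u v - B' u v| ≤ ε) :
    |hafnian B - hafnian B'|
      ≤ (perfectMatchings V).card * ((Fintype.card V / 2 : ℕ) * β ^ (Fintype.card V / 2 - 1) * ε) := by
  unfold hafnian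
  rw [← Finset.sum_sub_distrib]
  refine (Finset.abs_sum_le_sum_abs _ _).trans ?_
  refine (Finset.sum_le_card_nsmul _ _ _ fun τ hτ => ?_).trans (by rw [nsmul_eq_mul])
  have h := abs_prod_sub_prod_le (Finset.univ.filter fun v => v < τ v) hβ (fun i _ => hB i (τ i)) (fun i _ => hB' i (τ i))
    (fun i _ => hBB' i (τ i))
  rwa [card_filter_lt_of_mem_perfectMatchings hτ] at h

/-- The same on `2k` indices: `|Haf B − Haf B′| ≤ (2k−1)!!·k·β^{k−1}·ε`. [folklore] -/
theorem abs_hafnian_sub_hafnian_le_of_card {B B' : Matrix V V ℝ} {β ε : ℝ} {k : ℕ} (hV : Fintype.card V = 2 * k) (hβ : 0 ≤ β)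
    (hB : ∀ u v, |B u v| ≤ β) (hB' : ∀ u v, |B' u v| ≤ β) (hBB' : ∀ u v, |B u v - B' u v| ≤ ε) :
    |hafnian B - hafnian B'| ≤ (Nat.doubleFactorial (2 * k - 1) : ℝ) * (k * β ^ (k - 1) * ε) := by
  have h := abs_hafnian_sub_hafnian_le hβ hB hB' hBB'
  rwa [card_perfectMatchings hV, hV, Nat.mul_div_cancel_left _ two_pos] at h

end HafnianAnalysis

end Summit.QuantumFields.YangMills.BalabanUVNodes.N15KingModelRung.FreeField

namespace Summit.QuantumFields.YangMills.BalabanUVNodes.N15KingModelRung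

open Literature.MathematicalPhysics.QuantumFieldTheory (gaussianFieldOfKernel)
open Literature.MathematicalPhysics.QuantumFieldTheory.Balaban1983to89.B5Prop11Plancherel (Tor)
open Literature.MathematicalPhysics.QuantumFieldTheory.Balaban1983to89.QGQInverse (Coercive isUnit_of_coercive)
open Literature.MathematicalPhysics.QuantumFieldTheory.King1986 (aK aK_pos)
open Literature.MathematicalPhysics.QuantumFieldTheory.King1986.Torus
open Literature.Combinatorics.Enumerative (hafnian)
open Literature.Combinatorics.Enumerative.HafnianGeneratingFunction (subMat)
open FreeField

/-! ## §2 FINE SIDE: the `n`-point functions of the block averages of the fine free field are hafnians of `S₂^{(K)}`; limits and the rate -/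

section Fine

variable {d : ℕ} (L : ℕ) (M : Fin (d + 1) → ℕ) [hM : ∀ ν, NeZero (M ν)]
variable {W : Type*} [DecidableEq W] [LinearOrder W]

/-- ★★★ **THE `n`-POINT SCHWINGER FUNCTIONS OF THE BLOCK FIELD ARE HAFNIANS OF THE BLOCK TWO-POINT FUNCTION**: for points `p : W → 𝕋_M` and a finite `S`,
`∫∏_{i∈S}φ(p_i) ρ_{P_K}(φ)dφ = Haf((S₂^{(K)}(p_u,p_v))_{u,v∈S})` (`P_K = (S₂^{(K)})⁻¹`; repeated points allowed; `A = 0`, `g = 0`).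
[cite: King1986, (2.6) p.652, (2.13) p.653, Thm 2.1 (2.23) p.654] -/
theorem integral_prod_eval_fineBlockLaw_eq_hafnian (N : ℕ) [NeZero N] {m2 : ℝ} (hm : 0 < m2) (p : W → Tor M) (S : Finset W) :
    ∫ φ : Tor M → ℝ, (∏ i ∈ S, φ (p i)) * gaussDensity (fineBlockPrec M N m2) φ
      = hafnian (subMat (Matrix.of fun u v : W => kingS2 N M m2 (p u) (p v)) S) := by
  rw [integral_prod_eval_gaussDensity_eq_hafnian hm (coercive_fineBlockPrec M N hm) (fineBlockPrec_transpose M N m2) p S]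
  simp only [fineBlockPrec_inv M N hm, Matrix.of_apply]

/-- Smeared: `∫∏_{i∈S}⟨J_i,φ⟩ ρ_{P_K}(φ)dφ = Haf((⟨J_u, S₂^{(K)}J_v⟩)_{u,v∈S})`. [cite: King1986, (2.13) p.653, Thm 2.1 (2.23) p.654] -/
theorem integral_prod_dot_fineBlockLaw_eq_hafnian (N : ℕ) [NeZero N] {m2 : ℝ} (hm : 0 < m2) (J : W → Tor M → ℝ) (S : Finset W) :
    ∫ φ : Tor M → ℝ, (∏ i ∈ S, J i ⬝ᵥ φ) * gaussDensity (fineBlockPrec M N m2) φ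
      = hafnian (subMat (Matrix.of fun u v : W => J u ⬝ᵥ (Matrix.of (kingS2 N M m2) *ᵥ J v)) S) := by
  rw [integral_prod_dot_gaussDensity_eq_hafnian hm (coercive_fineBlockPrec M N hm) (fineBlockPrec_transpose M N m2) J S,
    fineBlockPrec_inv M N hm]

/-- ★★ **THE `K = ∞` TWIN**: `∫∏_{i∈S}φ(p_i) ρ_{P_∞}(φ)dφ = Haf((S₂^{(∞)}(p_u,p_v))_{u,v∈S})`. [cite: King1986, (2.6) p.652, Thm 2.1 (2.22)–(2.23) p.654] -/
theorem integral_prod_eval_fineBlockLawLim_eq_hafnian (hLodd : Odd L) (hL : 2 ≤ L) {m2 : ℝ} (hm : 0 < m2) (p : W → Tor M)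
    (S : Finset W) :
    ∫ φ : Tor M → ℝ, (∏ i ∈ S, φ (p i)) * gaussDensity (fineBlockPrecLim M m2) φ
      = hafnian (subMat (Matrix.of fun u v : W => kingS2Lim M m2 (p u) (p v)) S) := by
  rw [integral_prod_eval_gaussDensity_eq_hafnian hm (coercive_fineBlockPrecLim L M hLodd hL hm) (fineBlockPrecLim_transpose M m2) p S]
  simp only [fineBlockPrecLim_inv L M hLodd hL hm, Matrix.of_apply]

/-- Odd `n`-point functions of the block field vanish. [folklore] -/
theorem integral_prod_eval_fineBlockLaw_eq_zero_of_odd (N : ℕ) [NeZero N] {m2 : ℝ} (hm : 0 < m2) (p : W → Tor M) {S : Finset W}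
    (hodd : Odd S.card) :
    ∫ φ : Tor M → ℝ, (∏ i ∈ S, φ (p i)) * gaussDensity (fineBlockPrec M N m2) φ = 0 := by
  have h := integral_prod_dot_gaussDensity_eq_zero_of_odd hm (coercive_fineBlockPrec M N hm) (fineBlockPrec_transpose M N m2)
    (fun i => Pi.single (p i) (1 : ℝ)) hodd
  simp only [single_one_dotProduct] at h
  exact h

/-- ★★ **EVERY `n`-POINT FUNCTION CONVERGES** as `K → ∞` (the hafnian is continuous in the entries; part Ϝ-d's `tendsto_kingS2`).
[cite: King1986, Thm 2.1 (2.22)–(2.23) p.654] -/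
theorem tendsto_integral_prod_eval_fineBlockLaw (hLodd : Odd L) (hL : 2 ≤ L) {m2 : ℝ} (hm : 0 < m2) (p : W → Tor M) (S : Finset W) :
    haveI : NeZero L := ⟨by omega⟩
    Tendsto (fun K : ℕ => ∫ φ : Tor M → ℝ, (∏ i ∈ S, φ (p i)) * gaussDensity (fineBlockPrec M (L ^ K) m2) φ) atTop
      (𝓝 (∫ φ : Tor M → ℝ, (∏ i ∈ S, φ (p i)) * gaussDensity (fineBlockPrecLim M m2) φ)) := by
  haveI : NeZero L := ⟨by omega⟩
  have e : (fun K : ℕ => ∫ φ : Tor M → ℝ, (∏ i ∈ S, φ (p i)) * gaussDensity (fineBlockPrec M (L ^ K) m2) φ)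
      = fun K => hafnian (subMat (Matrix.of fun u v : W => kingS2 (L ^ K) M m2 (p u) (p v)) S) :=
    funext fun K => integral_prod_eval_fineBlockLaw_eq_hafnian M (L ^ K) hm p S
  rw [e, integral_prod_eval_fineBlockLawLim_eq_hafnian L M hLodd hL hm p S]
  exact tendsto_hafnian_of_entries fun u v => tendsto_kingS2 L M hLodd hL hm (p u) (p v)

/-- ★★★ **THE RATE OF EVERY `n`-POINT SCHWINGER FUNCTION** (Lemma 4.5 (4.38)'s shape propagated through Isserlis): for `2k` points and every `K ≥ 1`,
`|S_{2k}^{(K)}(p) − S_{2k}^{(∞)}(p)| ≤ (2k−1)!!·k·(m⁻²)^{k−1}·(2C_diff + a_∞⁻¹)·L^{−K}` — volume-free, from `|S₂^{(K)}|,|S₂^{(∞)}| ≤ m⁻²` (part Ϝ-d) and the uniform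
two-point rate (part Ϝ-l) by the Lipschitz estimate for the hafnian (auxiliary `a > 0` free). [cite: King1986, Lemma 4.5 (4.38) p.674, Thm 2.1 (2.22)–(2.23) p.654] -/
theorem abs_integral_prod_eval_fineBlockLaw_sub_lim_le (hLodd : Odd L) (hL : 2 ≤ L) {a m2 : ℝ} (ha : 0 < a) (hm : 0 < m2) {K : ℕ}
    (hK : 1 ≤ K) (p : W → Tor M) {S : Finset W} {k : ℕ} (hS : S.card = 2 * k) :
    haveI : NeZero L := ⟨by omega⟩
    |(∫ φ : Tor M → ℝ, (∏ i ∈ S, φ (p i)) * gaussDensity (fineBlockPrec M (L ^ K) m2) φ)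
        - ∫ φ : Tor M → ℝ, (∏ i ∈ S, φ (p i)) * gaussDensity (fineBlockPrecLim M m2) φ|
      ≤ (Nat.doubleFactorial (2 * k - 1) : ℝ)
          * (k * (m2⁻¹) ^ (k - 1) * ((2 * CdiffM (d + 1) a m2 L + (aInf a L)⁻¹) * ((L : ℝ) ^ K)⁻¹)) := by
  haveI : NeZero L := ⟨by omega⟩
  rw [integral_prod_eval_fineBlockLaw_eq_hafnian M (L ^ K) hm p S, integral_prod_eval_fineBlockLawLim_eq_hafnian L M hLodd hL hm p S]
  refine abs_hafnian_sub_hafnian_le_of_card (by rw [Fintype.card_coe, hS]) (inv_nonneg.mpr hm.le) (fun u v => ?_) (fun u v => ?_)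
    (fun u v => ?_)
  · exact abs_kingS2_le (L ^ K) M hm _ _
  · exact abs_kingS2Lim_le L M hLodd hL hm _ _
  · exact abs_kingS2_sub_lim_le_unif L M hLodd hL ha hm hK _ _

end Fine

/-! ## §3 RG SIDE: the `n`-point functions of King's block-field measures `dμ^{(K)}` are hafnians of `(Δ^{(K)})⁻¹`; `K = ∞`; limits -/

section RG

variable {d : ℕ} (L : ℕ) (M : Fin (d + 1) → ℕ) [hM : ∀ ν, NeZero (M ν)]
variable {W : Type*} [DecidableEq W] [LinearOrder W]

/-- ★★★ **THE `n`-POINT FUNCTIONS OF KING's LEVEL-`K` BLOCK-FIELD MEASURE ARE HAFNIANS OF NE2's UNIT-LAYER KERNEL**: for `K ≥ 1`,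
`∫∏_{i∈S}ψ(p_i) ρ_{Δ^{(K)}}(ψ)dψ = Haf(((Δ^{(K)})⁻¹(p_u,p_v))_{u,v∈S})`, `(Δ^{(K)})⁻¹ = blockCov K`. [cite: King1986, (2.6) p.652, (2.14) p.653] -/
theorem integral_prod_eval_blockFieldLaw_eq_hafnian (hL : 2 ≤ L) {a m2 : ℝ} (ha : 0 < a) (hm : 0 < m2) {K : ℕ} (hK : 1 ≤ K)
    (p : W → Tor M) (S : Finset W) :
    haveI : NeZero L := ⟨by omega⟩
    ∫ ψ : Tor M → ℝ, (∏ i ∈ S, ψ (p i)) * gaussDensity (effLaplacian (L ^ K) M (aK a L K) (((L ^ K : ℕ) : ℝ) ^ 2) m2) ψ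
      = hafnian (subMat (Matrix.of fun u v : W => blockCov L (L ^ K) M a m2 K (p u) (p v)) S) := by
  haveI : NeZero L := ⟨by omega⟩
  exact integral_prod_eval_gaussDensity_eq_hafnian (unifCoercive_pos L hL ha hm) (coercive_effLaplacian_unif L M hL ha hm hK)
    (effLaplacian_transpose_eq (L ^ K) M _ _ _) p S

/-- ★★ **THE `K = ∞` TWIN**: `∫∏_{i∈S}ψ(p_i) dμ^{(∞)} = Haf((C^{(∞)}(p_u,p_v))_{u,v∈S})` (King's continuum unit-lattice action, closed-form `C^{(∞)}`).
[cite: King1986, (2.14)–(2.16) p.653, Thm 2.1 (2.22) p.654] -/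
theorem integral_prod_eval_blockFieldLawLim_eq_hafnian (hLodd : Odd L) (hL : 2 ≤ L) {a m2 : ℝ} (ha : 0 < a) (hm : 0 < m2)
    (p : W → Tor M) (S : Finset W) :
    ∫ ψ : Tor M → ℝ, (∏ i ∈ S, ψ (p i)) * gaussDensity (Matrix.of fun b b' => effLaplacianLim L M a m2 b b') ψ
      = hafnian (subMat (Matrix.of fun u v : W => blockCovLim L M a m2 (p u) (p v)) S) := by
  rw [integral_prod_eval_gaussDensity_eq_hafnian (limCoercive_pos L hL ha hm) (coercive_effLaplacianLim L M hLodd hL ha hm)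
    (effLaplacianLim_transpose_eq L M a m2) p S, ← blockCovLim_eq_inv L M hLodd hL ha hm]
  simp only [Matrix.of_apply]

/-- Odd `n`-point functions of `dμ^{(K)}` vanish. [folklore] -/
theorem integral_prod_eval_blockFieldLaw_eq_zero_of_odd (hL : 2 ≤ L) {a m2 : ℝ} (ha : 0 < a) (hm : 0 < m2) {K : ℕ} (hK : 1 ≤ K)
    (p : W → Tor M) {S : Finset W} (hodd : Odd S.card) :
    haveI : NeZero L := ⟨by omega⟩
    ∫ ψ : Tor M → ℝ, (∏ i ∈ S, ψ (p i)) * gaussDensity (effLaplacian (L ^ K) M (aK a L K) (((L ^ K : ℕ) : ℝ) ^ 2) m2) ψ = 0 := by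
  haveI : NeZero L := ⟨by omega⟩
  have h := integral_prod_dot_gaussDensity_eq_zero_of_odd (unifCoercive_pos L hL ha hm) (coercive_effLaplacian_unif L M hL ha hm hK)
    (effLaplacian_transpose_eq (L ^ K) M _ _ _) (fun i => Pi.single (p i) (1 : ℝ)) hodd
  simp only [single_one_dotProduct] at h
  exact h

/-- ★★ **EVERY `n`-POINT FUNCTION OF `dμ^{(K)}` CONVERGES** to that of `dμ^{(∞)}` as `K → ∞` (part Ϡ-g's `tendsto_blockCov`).
[cite: King1986, Thm 2.1 (2.22) p.654, Thm 3.4 (3.9) p.656] -/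
theorem tendsto_integral_prod_eval_blockFieldLaw (hLodd : Odd L) (hL : 2 ≤ L) {a m2 : ℝ} (ha : 0 < a) (hm : 0 < m2) (p : W → Tor M)
    (S : Finset W) :
    haveI : NeZero L := ⟨by omega⟩
    Tendsto (fun K : ℕ => ∫ ψ : Tor M → ℝ, (∏ i ∈ S, ψ (p i))
        * gaussDensity (effLaplacian (L ^ K) M (aK a L K) (((L ^ K : ℕ) : ℝ) ^ 2) m2) ψ) atTop
      (𝓝 (∫ ψ : Tor M → ℝ, (∏ i ∈ S, ψ (p i)) * gaussDensity (Matrix.of fun b b' => effLaplacianLim L M a m2 b b') ψ)) := by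
  haveI : NeZero L := ⟨by omega⟩
  rw [integral_prod_eval_blockFieldLawLim_eq_hafnian L M hLodd hL ha hm p S]
  refine (tendsto_hafnian_of_entries (g := subMat (Matrix.of fun u v : W => blockCovLim L M a m2 (p u) (p v)) S)
    (f := fun K => subMat (Matrix.of fun u v : W => blockCov L (L ^ K) M a m2 K (p u) (p v)) S)
    fun u v => tendsto_blockCov L M hLodd hL ha hm (p u) (p v)).congr' ?_
  filter_upwards [eventually_ge_atTop 1] with K hK
  exact (integral_prod_eval_blockFieldLaw_eq_hafnian L M hL ha hm hK p S).symm

/-- ★★ The same `n`-point functions read on the tree's Kolmogorov-built field: `∫∏_{i∈S}ψ(p_i) d(gaussianFieldOfKernel (Δ^{(K)})⁻¹) = Haf(((Δ^{(K)})⁻¹(p_u,p_v)))`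
(part Ϝ-v's identification `dμ^{(K)} = gaussianFieldOfKernel (blockCov K)`). [cite: King1986, (2.6) p.652, (2.14) p.653] -/
theorem integral_prod_eval_gaussianFieldOfKernel_blockCov_eq_hafnian (hL : 2 ≤ L) {a m2 : ℝ} (ha : 0 < a) (hm : 0 < m2) {K : ℕ}
    (hK : 1 ≤ K) (p : W → Tor M) (S : Finset W) :
    haveI : NeZero L := ⟨by omega⟩
    ∫ ψ, (∏ i ∈ S, ψ (p i)) ∂gaussianFieldOfKernel (blockCov L (L ^ K) M a m2 K)
      = hafnian (subMat (Matrix.of fun u v : W => blockCov L (L ^ K) M a m2 K (p u) (p v)) S) := by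
  haveI : NeZero L := ⟨by omega⟩
  rw [← blockFieldLaw_eq_gaussianFieldOfKernel L M hL ha hm hK,
    integral_gaussLaw_real (unifCoercive_pos L hL ha hm) (coercive_effLaplacian_unif L M hL ha hm hK)]
  exact integral_prod_eval_blockFieldLaw_eq_hafnian L M hL ha hm hK p S

end RG

end Summit.QuantumFields.YangMills.BalabanUVNodes.N15KingModelRung
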